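import Summits.BirchSwinnertonDyer.BirchSwinnertonDyer.Theorems.TwoAdicConverseBDPAcLineCoinvariantDatumGoodOrd
import Literature.NumberTheory.EllipticCurves.OrdinaryReductionUnramifiedCharacterProofs
import HarnessLib

/-!
# AC-LINE COINVARIANT DATUM (part IV, KERNEL): the ordinary shape, the combined datum, the door and (e15) with the two
# Greenberg print facts DISCHARGED (crux `BDPSelmerLowerDivisibilityAtTwo`, stmt-BirchSwinnertonDyer-24728; route
# `TwoAdicConverse`, S3)

Helper file `--supports stmt-BirchSwinnertonDyer-24728` (cell `bsd-2adic`, seat `bsd-2adic-tower-1` GEN 56; key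
«F4 DISCHARGE», pen RC-666).  THEOREMS ONLY (no definition, no named fact, no instance, no `sorry`).  Parts II/III
(`…AcLineCoinvariantDatum`, p793101; `…AcLineCoinvariantDatumGoodOrd`, p793449) delivered the ordinary shape `hord`, the
AC-LINE COINVARIANT DATUM, the door's control input and the (e15) inequality `1 + a ≤ k + m` at (β) modulo exactly the two
NAMED PRINT FACTS of `Literature/…/OrdinaryReductionTorsionCharacters` (Greenberg LNM 1716 §2):
F4a `ordinaryReduction_inertia_smul_of_mem_kernelReduction` ("`ψ` and `χ` become equal after restriction to the inertia
subgroup") and F4b `ordinaryReduction_exists_unramified_character_mod_kernelReduction` ("`E[p^∞]/C_v` is the maximal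
unramified quotient … the action on `Ẽ[p^∞]` is by a character `φ` … `φ` has infinite order").  Both are now THEOREMS of
the tree (`ordinaryReduction_inertia_smul_of_mem_kernelReduction_holds`, `OrdinaryReductionTorsionCharactersProofs`;
`ordinaryReduction_exists_unramified_character_mod_kernelReduction_holds`, `OrdinaryReductionUnramifiedCharacterProofs`;
read off the tree's pinned reduction map at a good ordinary `v ∣ p`, its Tate module `T_p(C_v)`, `det ρ = χ_p`, and the
finiteness of `Ẽ` over finite fields).  This file is the one-screen substitution:

* `ordinaryShapeAtFrobPow` — part II's `ordinaryShapeAtFrobPow_of_print`, fact-free;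
* ★ `acLineCoinvariantDatumAtTwo`, ★ `acLineControl`, ★ `one_add_le_of_fibrePinned_of_rankOne` — the (hgood, hord)
  versions, fact-free;
* ★ `acLineCoinvariantDatumAtTwo_of_goodOrd`, ★ `acLineControl_of_goodOrd`,
  ★★ `one_add_le_of_fibrePinned_of_rankOne_of_goodOrd` — **(e15) `1 + a ≤ k + m` at (β), NONDEG₀ / BUDGET through the same
  door: KERNEL, every binder the habitat's** (`W/ℚ` globally minimal with `GoodOrd W 2`, `K` imaginary quadratic, `2`
  split `v ≠ v̄`, `κ₂` anticyclotomic generator pair, `rank E(K) = 1`, `#Ш[2^∞] < ∞`, the pinning datum, `ch(X_Gr₂) = (C₀)`);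
  door residual = ∅.

HONEST LABELS: the door is the NECESSARY side (FibrePinned ⟹ `1 + a ≤ k + m`); ACPIN (the Λ-side lower bound) stays a
research stub; the count of record of O2 (stmt 24728) is UNCHANGED; nothing closes at the ∀-level; BSD is proved for no
curve; typed ≠ proved — but here nothing typed remains: every hypothesis below is habitat data.
-/

-- D-0017: single-problem summit, the namespace repeats the problem name by design.
set_option linter.dupNamespace false
set_option autoImplicit false

noncomputable section

open scoped Classical

open NumberField IsDedekindDomain Field WeierstrassCurve
open Literature.NumberTheory.EllipticCurves Literature.NumberTheory.GaloisRepresentations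
  Literature.NumberTheory.EllipticCurves.GreenbergSelmer Literature.NumberTheory.EllipticCurves.ZpExtension
  Literature.NumberTheory.EllipticCurves.TwoVariableSelmer Literature.NumberTheory.EllipticCurves.Castella2018
open Summit.BirchSwinnertonDyer.Rank1Residual Literature.NumberTheory.EllipticCurves.Rank1Residual

namespace Summit.BirchSwinnertonDyer.BirchSwinnertonDyer.Theorems.TwoAdicBDPAcLineSpec

section General

variable {K : Type} [Field K] [NumberField K]

/-- **The ordinary shape at a Frobenius power, KERNEL**: part II's `ordinaryShapeAtFrobPow_of_print` with the two
Greenberg facts discharged — at a good ordinary `v̄ ∣ 2` of a quadratic `K`, for a Frobenius power `φ₀` of positive degree: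
a subgroup `F = C_{v̄} ⊆ E[2^∞]` on which an inertial `τ ∈ pairKer κ₁ κ₂` acts by `−1`, and `v` with
`φ₀ • (j m) − j m − 2^v m ∈ F` for suitable `j`, every `m ∈ E[2^∞]`.
[cite: GreenbergLNM1716, §2 pp. 70–71, 76] -/
theorem ordinaryShapeAtFrobPow (W' : WeierstrassCurve K) [W'.IsElliptic] (hK2 : Module.finrank ℚ K = 2)
    (κ₁ κ₂ : ZpExtension K 2) {v vbar : HeightOneSpectrum (𝓞 K)} (hv : ((2 : ℕ) : 𝓞 K) ∈ v.asIdeal)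
    (hvbar : ((2 : ℕ) : 𝓞 K) ∈ vbar.asIdeal) (hne : vbar ≠ v) (hgood : W'.HasGoodReductionAt vbar)
    (hord : ¬ ((2 : ℤ) ∣ W'.frobeniusTraceAt vbar))
    (φ₀ : absoluteGaloisGroup (vbar.adicCompletion K)) (m : ℕ) (hm : 0 < m) (hfrob : IsFrobPow φ₀ (m : ℤ)) :
    ∃ F : AddSubgroup (W'.geomPrimaryTorsion 2),
      (∃ τ : absoluteGaloisGroup K, τ ∈ ZpExtension.pairKer κ₁ κ₂ ∧ τ ∈ inertia vbar ∧ ∀ n ∈ F, τ • n = -n) ∧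
      ∃ v : ℕ, ∀ m : W'.geomPrimaryTorsion 2, ∃ j : ℤ,
        absGaloisRestrict K (vbar.adicCompletion K) φ₀ • (j • m) - j • m - 2 ^ v • m ∈ F :=
  ordinaryShapeAtFrobPow_of_print ordinaryReduction_inertia_smul_of_mem_kernelReduction_holds
    ordinaryReduction_exists_unramified_character_mod_kernelReduction_holds W' hK2 κ₁ κ₂ hv hvbar hne hgood hord φ₀ m
    hm hfrob

/-- ★ **THE AC-LINE COINVARIANT DATUM AT TWO, KERNEL** (part II's `acLineCoinvariantDatumAtTwo_of_print`, facts
discharged): for `W/ℚ`, `K` imaginary quadratic, `2` split `v ≠ v̄`, `κ₂` anticyclotomic, `E_K` good ordinary at `v̄`: an element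
`φ ∈ ker κ₂ ⊓ D_{v̄}` generating it topologically modulo `pairKer ⊓ I_{v̄}` (hgen), together with the ordinary shape (hord).
[cite: GreenbergLNM1716, §2 pp. 70–71, 76] -/
theorem acLineCoinvariantDatumAtTwo (W : WeierstrassCurve ℚ) [W.IsElliptic] (hK : IsImaginaryQuadratic K)
    (κ₁ κ₂ : ZpExtension K 2) (hκ₂ : κ₂.IsAnticyclotomic) {v vbar : HeightOneSpectrum (𝓞 K)}
    (hv : ((2 : ℕ) : 𝓞 K) ∈ v.asIdeal) (hvbar : ((2 : ℕ) : 𝓞 K) ∈ vbar.asIdeal) (hne : vbar ≠ v)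
    (hgood : (W.baseChange K).HasGoodReductionAt vbar) (hord : ¬ ((2 : ℤ) ∣ (W.baseChange K).frobeniusTraceAt vbar)) :
    ∃ φ : absoluteGaloisGroup K, φ ∈ κ₂.kerSubgroup ⊓ decomp vbar ∧
      κ₂.kerSubgroup ⊓ decomp vbar ≤ (Subgroup.closure ({φ} ∪
        ((ZpExtension.pairKer κ₁ κ₂ ⊓ inertia vbar : Subgroup (absoluteGaloisGroup K)) :
          Set (absoluteGaloisGroup K)))).topologicalClosure ∧
      ∃ F : AddSubgroup ((W.baseChange K).geomPrimaryTorsion 2),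
        (∃ τ : absoluteGaloisGroup K, τ ∈ ZpExtension.pairKer κ₁ κ₂ ∧ τ ∈ inertia vbar ∧ ∀ n ∈ F, τ • n = -n) ∧
        ∃ v : ℕ, ∀ m : (W.baseChange K).geomPrimaryTorsion 2, ∃ j : ℤ, φ • (j • m) - j • m - 2 ^ v • m ∈ F :=
  acLineCoinvariantDatumAtTwo_of_print ordinaryReduction_inertia_smul_of_mem_kernelReduction_holds
    ordinaryReduction_exists_unramified_character_mod_kernelReduction_holds W hK κ₁ κ₂ hκ₂ hv hvbar hne hgood hord

/-- ★ **THE DOOR'S CONTROL INPUT `hctl`, KERNEL** (part II's `acLineControl_of_print`, facts discharged): for a generator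
pair `(γ₁, γ₂)` and `s ∈ unrSelmer₂` fixed by `γ₁`, `2^m s` lies in the image of `Sel_ac → unrSelmer₂`.
[cite: SkinnerUrban2014, Prop. 3.2.8 (p. 23)] [cite: GreenbergLNM1716, §2 pp. 70–71, 76] -/
theorem acLineControl (W : WeierstrassCurve ℚ) [W.IsElliptic] (hK : IsImaginaryQuadratic K)
    (κ₁ κ₂ : ZpExtension K 2) (γ₁ γ₂ : absoluteGaloisGroup K) [Fact (ZpExtension.IsTopGeneratorPair κ₁ κ₂ γ₁ γ₂)]
    (hκ₂ : κ₂.IsAnticyclotomic) {v vbar : HeightOneSpectrum (𝓞 K)} (hv : ((2 : ℕ) : 𝓞 K) ∈ v.asIdeal)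
    (hvbar : ((2 : ℕ) : 𝓞 K) ∈ vbar.asIdeal) (hne : vbar ≠ v)
    (hgood : (W.baseChange K).HasGoodReductionAt vbar) (hord : ¬ ((2 : ℤ) ∣ (W.baseChange K).frobeniusTraceAt vbar)) :
    ∃ m : ℕ, ∀ s : unrSelmer₂ κ₁ κ₂ ((W.baseChange K).geomPrimaryTorsion 2) vbar,
      conjSel₂ κ₁ κ₂ ((W.baseChange K).geomPrimaryTorsion 2) vbar γ₁ s = s →
        2 ^ m • s ∈ Set.range ((W.baseChange K).selmerAcToUnrSelmer₂ 2 κ₁ κ₂ vbar) :=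
  acLineControl_of_print ordinaryReduction_inertia_smul_of_mem_kernelReduction_holds
    ordinaryReduction_exists_unramified_character_mod_kernelReduction_holds W hK κ₁ κ₂ γ₁ γ₂ hκ₂ hv hvbar hne hgood hord

/-- ★ **THE AC-LINE COINVARIANT DATUM AT TWO ON THE HABITAT, KERNEL** (part III's `…_of_print_of_goodOrd`, facts
discharged): the local good-ordinary hypothesis at `v̄` read off `GoodOrd W 2`.
[cite: GreenbergLNM1716, §2 pp. 70–71, 76] [cite: SilvermanAEC2009, Prop. VII.5.1(a)] -/
theorem acLineCoinvariantDatumAtTwo_of_goodOrd (W : WeierstrassCurve ℚ) [W.IsElliptic] [W.IsGloballyMinimal]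
    (hW : GoodOrd W 2) (hK : IsImaginaryQuadratic K) (κ₁ κ₂ : ZpExtension K 2) (hκ₂ : κ₂.IsAnticyclotomic)
    {v vbar : HeightOneSpectrum (𝓞 K)} (hv : ((2 : ℕ) : 𝓞 K) ∈ v.asIdeal) (hvbar : ((2 : ℕ) : 𝓞 K) ∈ vbar.asIdeal)
    (hne : vbar ≠ v) :
    ∃ φ : absoluteGaloisGroup K, φ ∈ κ₂.kerSubgroup ⊓ decomp vbar ∧
      κ₂.kerSubgroup ⊓ decomp vbar ≤ (Subgroup.closure ({φ} ∪
        ((ZpExtension.pairKer κ₁ κ₂ ⊓ inertia vbar : Subgroup (absoluteGaloisGroup K)) :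
          Set (absoluteGaloisGroup K)))).topologicalClosure ∧
      ∃ F : AddSubgroup ((W.baseChange K).geomPrimaryTorsion 2),
        (∃ τ : absoluteGaloisGroup K, τ ∈ ZpExtension.pairKer κ₁ κ₂ ∧ τ ∈ inertia vbar ∧ ∀ n ∈ F, τ • n = -n) ∧
        ∃ v : ℕ, ∀ m : (W.baseChange K).geomPrimaryTorsion 2, ∃ j : ℤ, φ • (j • m) - j • m - 2 ^ v • m ∈ F :=
  acLineCoinvariantDatumAtTwo_of_print_of_goodOrd ordinaryReduction_inertia_smul_of_mem_kernelReduction_holds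
    ordinaryReduction_exists_unramified_character_mod_kernelReduction_holds W hW hK κ₁ κ₂ hκ₂ hv hvbar hne

/-- ★ **THE DOOR'S CONTROL INPUT `hctl` ON THE HABITAT, KERNEL** (part III's `acLineControl_of_print_of_goodOrd`, facts
discharged). [cite: SkinnerUrban2014, Prop. 3.2.8 (p. 23)] [cite: GreenbergLNM1716, §2 pp. 70–71, 76] -/
theorem acLineControl_of_goodOrd (W : WeierstrassCurve ℚ) [W.IsElliptic] [W.IsGloballyMinimal] (hW : GoodOrd W 2)
    (hK : IsImaginaryQuadratic K) (κ₁ κ₂ : ZpExtension K 2) (γ₁ γ₂ : absoluteGaloisGroup K)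
    [Fact (ZpExtension.IsTopGeneratorPair κ₁ κ₂ γ₁ γ₂)] (hκ₂ : κ₂.IsAnticyclotomic)
    {v vbar : HeightOneSpectrum (𝓞 K)} (hv : ((2 : ℕ) : 𝓞 K) ∈ v.asIdeal) (hvbar : ((2 : ℕ) : 𝓞 K) ∈ vbar.asIdeal)
    (hne : vbar ≠ v) :
    ∃ m : ℕ, ∀ s : unrSelmer₂ κ₁ κ₂ ((W.baseChange K).geomPrimaryTorsion 2) vbar,
      conjSel₂ κ₁ κ₂ ((W.baseChange K).geomPrimaryTorsion 2) vbar γ₁ s = s →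
        2 ^ m • s ∈ Set.range ((W.baseChange K).selmerAcToUnrSelmer₂ 2 κ₁ κ₂ vbar) :=
  acLineControl_of_print_of_goodOrd ordinaryReduction_inertia_smul_of_mem_kernelReduction_holds
    ordinaryReduction_exists_unramified_character_mod_kernelReduction_holds W hW hK κ₁ κ₂ γ₁ γ₂ hκ₂ hv hvbar hne

end General

section Inequality

variable (W : WeierstrassCurve ℚ) [W.IsElliptic] [W.IsGloballyMinimal]
  {K : Type} [Field K] [NumberField K]
  (κ₁ κ₂ : ZpExtension K 2) (vbar : HeightOneSpectrum (𝓞 K)) (γ₁ γ₂ : absoluteGaloisGroup K)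
  [Fact (ZpExtension.IsTopGeneratorPair κ₁ κ₂ γ₁ γ₂)] [Fact (κ₂.IsTopGenerator γ₂)]
  (J : ℤ_[2] →+* PadicComplexInt 2) (C₀ : IwasawaAlgebra₂ 2) (G : PowerSeries (PowerSeries (PadicComplexInt 2)))
  (hpin : ∃ 𝔓 : Ideal (PowerSeries (PowerSeries (IsLocalRing.ResidueField (PadicComplexInt 2)))),
    𝔓.IsPrime ∧ PowerSeries.map (PowerSeries.map (IsLocalRing.residue (PadicComplexInt 2))) G ∉ 𝔓 ∧
    ∀ (a : ℕ) (C₁ : PowerSeries (PowerSeries (PadicComplexInt 2))),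
      IwasawaAlgebra₂.toUnr₂ 2 J C₀ = (2 : PowerSeries (PowerSeries (PadicComplexInt 2))) ^ a * C₁ →
      PowerSeries.map (PowerSeries.map (IsLocalRing.residue (PadicComplexInt 2))) C₁ ≠ 0 →
      PowerSeries.map (PowerSeries.map (IsLocalRing.residue (PadicComplexInt 2))) C₁ ∈
        𝔓 ⊔ Ideal.span {PowerSeries.map (PowerSeries.map (IsLocalRing.residue (PadicComplexInt 2))) G})
  (hG0 : PowerSeries.constantCoeff (PowerSeries.constantCoeff G) ∈ IsLocalRing.maximalIdeal (PadicComplexInt 2))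
  (a : ℕ) (C₁ : PowerSeries (PowerSeries (PadicComplexInt 2)))
  (hC : IwasawaAlgebra₂.toUnr₂ 2 J C₀ = (2 : PowerSeries (PowerSeries (PadicComplexInt 2))) ^ a * C₁)
  (hC₁ : PowerSeries.map (PowerSeries.map (IsLocalRing.residue (PadicComplexInt 2))) C₁ ≠ 0)

include hpin hG0 hC hC₁

/-- ★ **(e15) on the rank-one data, KERNEL** (part II's `one_add_le_of_fibrePinned_of_rankOne_of_print`, facts discharged):
there are `m`, `k`, a unit `u` with `(J C₀)(0,0) ∣ 2^{k+m}·u` and `1 + a ≤ k + m`. [cite: GreenbergLNM1716, §2 pp. 70–71, 76] -/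
theorem one_add_le_of_fibrePinned_of_rankOne (hK : IsImaginaryQuadratic K) (hsplit : X11b.SplitsIn K 2)
    (hκ₂ : κ₂.IsAnticyclotomic) {v : HeightOneSpectrum (𝓞 K)} (hv : ((2 : ℕ) : 𝓞 K) ∈ v.asIdeal)
    (hvbar : ((2 : ℕ) : 𝓞 K) ∈ vbar.asIdeal) (hne : vbar ≠ v) (hgood : (W.baseChange K).HasGoodReductionAt vbar)
    (hord : ¬ ((2 : ℤ) ∣ (W.baseChange K).frobeniusTraceAt vbar)) (hrank : (W.baseChange K).mordellWeilRank = 1)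
    (hsha : Finite (AddCommGroup.primaryComponent (W.baseChange K).sha 2))
    (hC₀ : XGr₂.charIdeal (W.baseChange K) 2 κ₁ κ₂ vbar γ₁ γ₂ = Ideal.span {C₀}) :
    ∃ (m k : ℕ) (u : PadicComplexInt 2), AcSelmer.XAc.HasCharValuationAt (W.baseChange K) 2 κ₂ vbar ∅ γ₂ m ∧
      IsUnit u ∧ PowerSeries.constantCoeff (PowerSeries.constantCoeff (IwasawaAlgebra₂.toUnr₂ 2 J C₀)) ∣
        (2 : PadicComplexInt 2) ^ (k + m) * u ∧ 1 + a ≤ k + m :=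
  one_add_le_of_fibrePinned_of_rankOne_of_print W κ₁ κ₂ vbar γ₁ γ₂ J C₀ G hpin hG0 a C₁ hC hC₁
    ordinaryReduction_inertia_smul_of_mem_kernelReduction_holds
    ordinaryReduction_exists_unramified_character_mod_kernelReduction_holds hK hsplit hκ₂ hv hvbar hne hgood hord hrank
    hsha hC₀

/-- ★★ **(e15) ON THE HABITAT, KERNEL — every binder the habitat's, door residual ∅** (part III's
`one_add_le_of_fibrePinned_of_rankOne_of_print_of_goodOrd` with F4a/F4b DISCHARGED): for globally minimal `W/ℚ` with
`GoodOrd W 2`, `K` imaginary quadratic in which `2` splits, `v ≠ v̄` above `2`, `κ₂` anticyclotomic with generator pair,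
`rank E(K) = 1`, `#Ш[2^∞] < ∞`, the pinning datum and `ch_{Λ_K}(X_Gr₂) = (C₀)`: there are `m`, `k`, a unit `u` with
`(J C₀)(0,0) ∣ 2^{k+m}·u` and **`1 + a ≤ k + m`**. [folklore] [cite: GreenbergLNM1716, §2 pp. 70–71, 76] -/
theorem one_add_le_of_fibrePinned_of_rankOne_of_goodOrd (hW : GoodOrd W 2) (hK : IsImaginaryQuadratic K)
    (hsplit : X11b.SplitsIn K 2) (hκ₂ : κ₂.IsAnticyclotomic) {v : HeightOneSpectrum (𝓞 K)}
    (hv : ((2 : ℕ) : 𝓞 K) ∈ v.asIdeal) (hvbar : ((2 : ℕ) : 𝓞 K) ∈ vbar.asIdeal) (hne : vbar ≠ v)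
    (hrank : (W.baseChange K).mordellWeilRank = 1)
    (hsha : Finite (AddCommGroup.primaryComponent (W.baseChange K).sha 2))
    (hC₀ : XGr₂.charIdeal (W.baseChange K) 2 κ₁ κ₂ vbar γ₁ γ₂ = Ideal.span {C₀}) :
    ∃ (m k : ℕ) (u : PadicComplexInt 2), AcSelmer.XAc.HasCharValuationAt (W.baseChange K) 2 κ₂ vbar ∅ γ₂ m ∧
      IsUnit u ∧ PowerSeries.constantCoeff (PowerSeries.constantCoeff (IwasawaAlgebra₂.toUnr₂ 2 J C₀)) ∣
        (2 : PadicComplexInt 2) ^ (k + m) * u ∧ 1 + a ≤ k + m :=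
  one_add_le_of_fibrePinned_of_rankOne_of_print_of_goodOrd W κ₁ κ₂ vbar γ₁ γ₂ J C₀ G hpin hG0 a C₁ hC hC₁
    ordinaryReduction_inertia_smul_of_mem_kernelReduction_holds
    ordinaryReduction_exists_unramified_character_mod_kernelReduction_holds hW hK hsplit hκ₂ hv hvbar hne hrank hsha hC₀

end Inequality

end Summit.BirchSwinnertonDyer.BirchSwinnertonDyer.Theorems.TwoAdicBDPAcLineSpec

end
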